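import Mathlib.Analysis.Distribution.SchwartzSpace.Fourier
import Mathlib.Analysis.InnerProductSpace.PiL2
import Mathlib.Analysis.Calculus.Deriv.Basic
import HarnessLib

/-!
# The Cohn–Kumar–Miller–Radchenko–Viazovska interpolation theorem for radial Schwartz functions
# (`d = 8`, nodes `√(2n)`, `n ≥ 1`; `d = 24`, `n ≥ 2`) — Theorems 1.7 and 1.9 as named facts

Topic: `Literature/Analysis/Fourier`. Requested (work item `wi-12364`) by the route
`ZeroPressureMagicLadder` of `AtomisticToContinuum/Crystallization`, crux `E8Rung`: the
interpolation formula and the interpolation isomorphism of Cohn–Kumar–Miller–Radchenko–Viazovska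
(CKMRV) in dimension `8`, and the resulting "forced" form (1.5) of a sharp auxiliary function.
Companions: `Literature/Algebra/EuclideanLattices/E8Lattice.lean` (the lattice `Λ₈`, whose nonzero
vectors have exactly the lengths `√(2n)`, `n ≥ 1`) and
`Literature/MathematicalPhysics/StatisticalMechanics/E8Configuration.lean` (Poisson summation
over `Λ₈`, `Λ₈` as a periodic configuration).

## The results, as printed (Ann. Math. 196 (2022) 983–1082 = arXiv:1902.05438, §1.4–§1.5)

Notation (§1.4): `𝓢_rad(ℝᵈ)` = radial Schwartz functions `ℝᵈ → ℂ`; for `f ∈ 𝓢_rad(ℝᵈ)`, `f(r)`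
is the common value of `f(x)` on `|x| = r` and `f′` the radial derivative; `f̂` is the
`d`-dimensional Fourier transform `f̂(y) = ∫ f(x) e^{-2πi⟨x,y⟩} dx` (§1.2), again radial, `f̂′` its
radial derivative. `𝓢(ℕ)` = rapidly decreasing complex sequences, `nᵏ xₙ → 0` for all `k`.

* **Theorem 1.7.** "Let `(d, n₀)` be `(8, 1)` or `(24, 2)`. Then every `f ∈ 𝓢_rad(ℝᵈ)` is
  uniquely determined by the values `f(√(2n))`, `f′(√(2n))`, `f̂(√(2n))`, and `f̂′(√(2n))` for
  integers `n ≥ n₀`. Specifically, there exists an interpolation basis `aₙ, bₙ, ãₙ, b̃ₙ ∈ 𝓢_rad(ℝᵈ)`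
  for `n ≥ n₀` such that for every `f ∈ 𝓢_rad(ℝᵈ)` and `x ∈ ℝᵈ`,
  `f(x) = ∑_{n ≥ n₀} f(√(2n)) aₙ(x) + ∑ f′(√(2n)) bₙ(x) + ∑ f̂(√(2n)) ãₙ(x) + ∑ f̂′(√(2n)) b̃ₙ(x)`
  (1.4), where these series converge absolutely."
* **Theorem 1.9.** "Let `(d, n₀)` be `(8, 1)` or `(24, 2)`. Then the map sending `f ∈ 𝓢_rad(ℝᵈ)`
  to `((f(√(2n)))_{n ≥ n₀}, (f′(√(2n)))_{n ≥ n₀}, (f̂(√(2n)))_{n ≥ n₀}, (f̂′(√(2n)))_{n ≥ n₀})` is an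
  isomorphism from `𝓢_rad(ℝᵈ)` to `𝓢(ℕ)⁴`, whose inverse is given by (1.4)."
  Consequences printed after it: no linear relations between the data; the basis functions have
  Kronecker data (`aₙ(√(2m)) = δ_{m,n}`, all other data `0`, cyclically); "Such a basis is
  uniquely determined, by the interpolation theorem itself"; `ãₙ = âₙ`, `b̃ₙ = b̂ₙ`.
* **(1.5)** (§1.5): "we can write down the only possible auxiliary function `f` that could prove a
  sharp bound for `E₈` or the Leech lattice under a potential `p` …, at least among radial Schwartz
  functions: `f(x) = ∑_{n ≥ n₀} p(√(2n)) aₙ(x) + ∑_{n ≥ n₀} p′(√(2n)) bₙ(x)`."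

## Lean rendering

* Radial Schwartz function on `ℝᵈ` = Mathlib Schwartz map `f : 𝓢(EuclideanSpace ℝ (Fin d), ℂ)`
  with `IsRadial f` (`f x = f y` whenever `‖x‖ = ‖y‖`). `f(r) := f(r e₀)` (`radialValue`, probe
  `axisPt d r = r e₀`), `f′(r) := d/dt f(t e₀)|_{t = r}` (`radialDeriv`); for `f = f₀(|·|)` these
  are `f₀(r)`, `f₀′(r)` at `r > 0` (`radialValue_comp_norm`, `radialDeriv_comp_norm`; CKMRV §2.3,
  Lemma 2.1: every radial Schwartz `f` is `f₀(|x|)` with `f₀` even Schwartz, `Df = f₀′(|x|)`).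
  `f̂ = 𝓕 f` is Mathlib's Fourier transform on Schwartz space, kernel `e^{-2πi⟨x,ξ⟩}` = CKMRV's.
* Nodes: `node n₀ n = √(2(n₀ + n))`, `n : ℕ` — the radii `√(2m)`, `m ≥ n₀`, enumerated from `n₀`
  (all `> 0` when `n₀ ≥ 1`). `𝓢(ℕ)`: `IsRapidlyDecreasing u := ∀ k, nᵏ ‖uₙ‖ → 0`.
* `IsInterpolationBasis d n₀ a b a' b'` — the conclusion (1.4) of Theorem 1.7 for a family (radial
  Schwartz; the four series absolutely convergent at every `x`; the identity). The NAMED FACTS are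
  `CKMRV2022_interpolationFormula` (Theorem 1.7: a basis exists for `(8,1)` and for `(24,2)`) and
  `CKMRV2022_interpolationIso` (Theorem 1.9, schema `InterpolationIsomorphism d n₀`).
* Theorem 1.9 is stated FOR EVERY interpolation basis rather than for "the" basis of Theorem 1.7:
  by the printed consequences (Kronecker data) any family satisfying (1.4) for all radial Schwartz
  `f` coincides with the CKMRV basis (apply (1.4) for the new family to `f = aₘ, bₘ, ãₘ, b̃ₘ` of the
  old one), so the universally quantified form is implied by, and with Theorem 1.7 implies, the
  printed one; it spares users an extraction of "the" basis from an existential.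
* PROVED here from the definitions: uniqueness (`IsInterpolationBasis.eq_of_data_eq`, the first
  sentence of Theorem 1.7), the forced form (1.5) under the necessary conditions
  (`IsInterpolationBasis.eq_forced`), and the Kronecker data of `aₘ` from the isomorphism
  (`InterpolationIsomorphism.data_a`).

## Not vendored here

Theorem 1.4 (universal optimality of `E₈` and the Leech lattice), Corollary 1.8 (uniqueness of the
sphere-packing / Gaussian auxiliary functions), Theorem 3.1 (functional equations ⇒ interpolation
formula, with at most polynomial growth in `n` of the radial seminorms of the basis — the input a
user needs to sum (1.5) against NON-rapidly-decreasing data such as inverse power laws), the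
generating functions (1.6)–(1.7) and the integral formulas of §5.4, `ãₙ = âₙ`, `b̃ₙ = b̂ₙ`, and the
topological (Fréchet) refinement of "isomorphism" (the printed statement is algebraic).

## Wording risks

* "Converge absolutely" is rendered pointwise in `x` for each of the four series separately, as
  printed in Theorem 1.7; Theorem 1.9's inverse map is rendered the same way (pointwise absolutely
  convergent series whose sum is a radial Schwartz function with the prescribed data).
* CKMRV take `f : ℝᵈ → ℂ` in Theorems 1.7/1.9 and a real `f` in Theorem 3.1; we use `ℂ` throughout;
  the potential profile in (1.5) is any `p : ℝ → ℂ` with `p′ = deriv p` (real potentials coerce).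
* `radialDeriv f r` is an honest radial derivative only where `t ↦ f(t e₀)` is differentiable
  (automatic for Schwartz `f`) and is read at the nodes `r = √(2m) > 0` only.

## References

* H. Cohn, A. Kumar, S. D. Miller, D. Radchenko, M. Viazovska, *Universal optimality of the `E₈` and
  Leech lattices and interpolation formulas*, Ann. of Math. 196 (2022) 983–1082, arXiv:1902.05438:
  §1.2 (Fourier normalisation), §1.4 (Theorem 1.7, (1.4), Corollary 1.8, Theorem 1.9 and the
  displays following it), §1.5 ((1.5)), §2.3 (Lemma 2.1, radial seminorms), §3.1 (Theorem 3.1),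
  §5.2–5.3 (proofs). [CohnEtAl2019]
* M. S. Viazovska, *The sphere packing problem in dimension 8*, Ann. of Math. 185 (2017), §4 (the
  `d = 8`, single-function precursor: `b₁` up to a constant). [Viazovska2017]
-/

noncomputable section

open scoped SchwartzMap FourierTransform Topology
open Filter

namespace Literature.Analysis.Fourier

/-! ## Radial functions; the value `f(r)` and the radial derivative `f′(r)` -/

section Radial

variable {V : Type*} [SeminormedAddCommGroup V] {F : Type*}

/-- A function on a (semi)normed group is **radial** if its value at `x` depends only on `‖x‖`
(Cohn–Kumar–Miller–Radchenko–Viazovska §1.4: "we abuse notation by applying `f` directly to radial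
distances (i.e., if `r ∈ [0,∞)`, then `f(r)` denotes the common value of `f(x)` when `|x| = r`)").
[cite: CohnEtAl2019, §1.4] -/
def IsRadial (f : V → F) : Prop :=
  ∀ ⦃x y : V⦄, ‖x‖ = ‖y‖ → f x = f y

/-- A function of the norm is radial (the functions `f₀(|x|)` of CKMRV Lemma 2.1). [folklore] -/
theorem isRadial_comp_norm (g : ℝ → F) : IsRadial fun x : V => g ‖x‖ :=
  fun _ _ h => by simp only [h]

/-- Constant functions are radial. [folklore] -/
theorem isRadial_const (c : F) : IsRadial fun _ : V => c := fun _ _ _ => rfl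

end Radial

variable {d : ℕ}

/-- The point `r e₀ = (r, 0, …, 0)` of `ℝᵈ` (`d ≥ 1`), of norm `|r|`: the probe at which the common
value `f(r)` of a radial `f` on the sphere of radius `r ≥ 0` is read off. [folklore] -/
def axisPt (d : ℕ) [NeZero d] (r : ℝ) : EuclideanSpace ℝ (Fin d) :=
  EuclideanSpace.single 0 r

/-- `‖r e₀‖ = |r|`. [folklore] -/
@[simp] theorem norm_axisPt [NeZero d] (r : ℝ) : ‖axisPt d r‖ = |r| := by
  simp [axisPt]

/-- **`f(r)`** for a function `f` on `ℝᵈ` and a radius `r`: the value at `r e₀` — for radial `f`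
and `r ≥ 0` the common value of `f` on the sphere `|x| = r` (CKMRV §1.4). [cite: CohnEtAl2019, §1.4] -/
def radialValue [NeZero d] (f : EuclideanSpace ℝ (Fin d) → ℂ) (r : ℝ) : ℂ :=
  f (axisPt d r)

/-- **`f′(r)`, the radial derivative** (CKMRV §1.4: "we let `f′` denote the radial derivative";
§2.3: `Df(x) = f₀′(|x|)` for `f(x) = f₀(|x|)`, `f₀` even): the derivative at `r` of
`t ↦ f(t e₀)`. [cite: CohnEtAl2019, §1.4 and §2.3] -/
def radialDeriv [NeZero d] (f : EuclideanSpace ℝ (Fin d) → ℂ) (r : ℝ) : ℂ :=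
  deriv (fun t : ℝ => f (axisPt d t)) r

/-- `radialValue` unfolds. [folklore] -/
theorem radialValue_def [NeZero d] (f : EuclideanSpace ℝ (Fin d) → ℂ) (r : ℝ) :
    radialValue f r = f (axisPt d r) := rfl

/-- `radialDeriv` unfolds. [folklore] -/
theorem radialDeriv_def [NeZero d] (f : EuclideanSpace ℝ (Fin d) → ℂ) (r : ℝ) :
    radialDeriv f r = deriv (fun t : ℝ => f (axisPt d t)) r := rfl

/-- A radial function is the function `f(|x|)` of its radial values. [cite: CohnEtAl2019, §1.4] -/
theorem IsRadial.apply_eq_radialValue [NeZero d] {f : EuclideanSpace ℝ (Fin d) → ℂ}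
    (hf : IsRadial f) (x : EuclideanSpace ℝ (Fin d)) : f x = radialValue f ‖x‖ :=
  hf (by simp)

/-- For `f(x) = f₀(‖x‖)`, `f(r) = f₀(r)` for `r ≥ 0`. [folklore] -/
theorem radialValue_comp_norm [NeZero d] (f₀ : ℝ → ℂ) {r : ℝ} (hr : 0 ≤ r) :
    radialValue (fun x : EuclideanSpace ℝ (Fin d) => f₀ ‖x‖) r = f₀ r := by
  simp [radialValue, abs_of_nonneg hr]

/-- For `f(x) = f₀(‖x‖)`, the radial derivative at `r > 0` is `f₀′(r)` (CKMRV §2.3,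
`Df(x) = f₀′(|x|)`). [cite: CohnEtAl2019, §2.3] -/
theorem radialDeriv_comp_norm [NeZero d] (f₀ : ℝ → ℂ) {r : ℝ} (hr : 0 < r) :
    radialDeriv (fun x : EuclideanSpace ℝ (Fin d) => f₀ ‖x‖) r = deriv f₀ r := by
  unfold radialDeriv
  apply Filter.EventuallyEq.deriv_eq
  filter_upwards [lt_mem_nhds hr] with t ht
  simp [abs_of_pos ht]

/-! ## Rapidly decreasing sequences and the interpolation nodes `√(2n)`, `n ≥ n₀` -/

/-- **Rapidly decreasing sequences** `𝓢(ℕ)` (CKMRV §1.4: "`(xₙ) ∈ 𝓢(ℕ)` if and only if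
`lim_{n → ∞} nᵏ xₙ = 0` for all `k`"). [cite: CohnEtAl2019, §1.4] -/
def IsRapidlyDecreasing (u : ℕ → ℂ) : Prop :=
  ∀ k : ℕ, Tendsto (fun n : ℕ => (n : ℝ) ^ k * ‖u n‖) atTop (𝓝 0)

/-- An eventually vanishing sequence is rapidly decreasing. [folklore] -/
theorem isRapidlyDecreasing_of_eventually_eq_zero {u : ℕ → ℂ} (hu : ∀ᶠ n in atTop, u n = 0) :
    IsRapidlyDecreasing u := fun k =>
  tendsto_const_nhds.congr' <| by
    filter_upwards [hu] with n hn
    simp [hn]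

/-- The zero sequence is rapidly decreasing. [folklore] -/
theorem isRapidlyDecreasing_zero : IsRapidlyDecreasing 0 :=
  isRapidlyDecreasing_of_eventually_eq_zero (Eventually.of_forall fun _ => rfl)

/-- The **interpolation nodes** `√(2(n₀ + n))`, `n = 0, 1, 2, …`, i.e. the radii `√(2m)`, `m ≥ n₀`,
of CKMRV Theorem 1.7 (`n₀ = 1` for `d = 8`: the lengths `√2, √4, √6, …` of the nonzero vectors of
`E₈`; `n₀ = 2` for `d = 24`: those of the Leech lattice), enumerated from `n₀`. [cite: CohnEtAl2019, §1.4] -/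
def node (n₀ n : ℕ) : ℝ :=
  Real.sqrt (2 * ((n₀ : ℝ) + n))

/-- The nodes are nonnegative. [folklore] -/
theorem node_nonneg (n₀ n : ℕ) : 0 ≤ node n₀ n := Real.sqrt_nonneg _

/-- `node n₀ n ^ 2 = 2 (n₀ + n)`. [folklore] -/
theorem node_sq (n₀ n : ℕ) : node n₀ n ^ 2 = 2 * ((n₀ : ℝ) + n) :=
  Real.sq_sqrt (by positivity)

/-- The nodes are positive as soon as `n₀ ≥ 1`. [folklore] -/
theorem node_pos {n₀ : ℕ} (h : 1 ≤ n₀) (n : ℕ) : 0 < node n₀ n :=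
  Real.sqrt_pos.2 (by have : (0 : ℝ) < n₀ := by exact_mod_cast h
                      positivity)

/-! ## Interpolation bases (CKMRV Theorem 1.7, formula (1.4)) -/

/-- An **interpolation basis** for radial Schwartz functions on `ℝᵈ` with nodes `√(2m)`, `m ≥ n₀`
(the conclusion of CKMRV Theorem 1.7 / formula (1.4) for a family `aₙ, bₙ, ãₙ, b̃ₙ`): radial
Schwartz functions `a n, b n, a' n, b' n` (our `n` enumerates `m = n₀ + n`; `a' = ã`, `b' = b̃`)
such that for every radial Schwartz `f : ℝᵈ → ℂ` and every `x ∈ ℝᵈ`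
`f(x) = ∑ f(√(2m)) aₘ(x) + ∑ f′(√(2m)) bₘ(x) + ∑ f̂(√(2m)) ãₘ(x) + ∑ f̂′(√(2m)) b̃ₘ(x)`,
each of the four series converging absolutely; here `f̂ = 𝓕 f` is the Fourier transform
`f̂(y) = ∫ f(x) e^{-2πi⟨x,y⟩} dx` (Mathlib's normalisation = CKMRV's, §1.2) and `f′`, `f̂′` are
radial derivatives (`radialDeriv`). [cite: CohnEtAl2019, §1.4 Theorem 1.7 and (1.4)] -/
structure IsInterpolationBasis (d n₀ : ℕ) [NeZero d]
    (a b a' b' : ℕ → 𝓢(EuclideanSpace ℝ (Fin d), ℂ)) : Prop where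
  isRadial_a : ∀ n, IsRadial (a n)
  isRadial_b : ∀ n, IsRadial (b n)
  isRadial_a' : ∀ n, IsRadial (a' n)
  isRadial_b' : ∀ n, IsRadial (b' n)
  summable_a : ∀ f : 𝓢(EuclideanSpace ℝ (Fin d), ℂ), IsRadial f → ∀ x,
    Summable fun n => ‖radialValue f (node n₀ n) * a n x‖
  summable_b : ∀ f : 𝓢(EuclideanSpace ℝ (Fin d), ℂ), IsRadial f → ∀ x,
    Summable fun n => ‖radialDeriv f (node n₀ n) * b n x‖
  summable_a' : ∀ f : 𝓢(EuclideanSpace ℝ (Fin d), ℂ), IsRadial f → ∀ x,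
    Summable fun n => ‖radialValue (𝓕 f : 𝓢(EuclideanSpace ℝ (Fin d), ℂ)) (node n₀ n) * a' n x‖
  summable_b' : ∀ f : 𝓢(EuclideanSpace ℝ (Fin d), ℂ), IsRadial f → ∀ x,
    Summable fun n => ‖radialDeriv (𝓕 f : 𝓢(EuclideanSpace ℝ (Fin d), ℂ)) (node n₀ n) * b' n x‖
  eq_tsum : ∀ f : 𝓢(EuclideanSpace ℝ (Fin d), ℂ), IsRadial f → ∀ x,
    f x = (∑' n, radialValue f (node n₀ n) * a n x) + (∑' n, radialDeriv f (node n₀ n) * b n x) +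
      (∑' n, radialValue (𝓕 f : 𝓢(EuclideanSpace ℝ (Fin d), ℂ)) (node n₀ n) * a' n x) +
      (∑' n, radialDeriv (𝓕 f : 𝓢(EuclideanSpace ℝ (Fin d), ℂ)) (node n₀ n) * b' n x)

namespace IsInterpolationBasis

variable [NeZero d] {n₀ : ℕ} {a b a' b' : ℕ → 𝓢(EuclideanSpace ℝ (Fin d), ℂ)}

/-- **Uniqueness** (the first sentence of CKMRV Theorem 1.7: "every `f ∈ 𝓢_rad(ℝᵈ)` is uniquely
determined by the values `f(√(2n))`, `f′(√(2n))`, `f̂(√(2n))`, and `f̂′(√(2n))` for integers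
`n ≥ n₀`"), from the interpolation formula: two radial Schwartz functions with the same four data
sequences coincide. [cite: CohnEtAl2019, §1.4 Theorem 1.7] -/
theorem eq_of_data_eq (h : IsInterpolationBasis d n₀ a b a' b')
    {f g : 𝓢(EuclideanSpace ℝ (Fin d), ℂ)} (hf : IsRadial f) (hg : IsRadial g)
    (h₁ : ∀ n, radialValue f (node n₀ n) = radialValue g (node n₀ n))
    (h₂ : ∀ n, radialDeriv f (node n₀ n) = radialDeriv g (node n₀ n))
    (h₃ : ∀ n, radialValue (𝓕 f : 𝓢(EuclideanSpace ℝ (Fin d), ℂ)) (node n₀ n) =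
      radialValue (𝓕 g : 𝓢(EuclideanSpace ℝ (Fin d), ℂ)) (node n₀ n))
    (h₄ : ∀ n, radialDeriv (𝓕 f : 𝓢(EuclideanSpace ℝ (Fin d), ℂ)) (node n₀ n) =
      radialDeriv (𝓕 g : 𝓢(EuclideanSpace ℝ (Fin d), ℂ)) (node n₀ n)) :
    f = g := by
  ext x
  rw [h.eq_tsum f hf x, h.eq_tsum g hg x]
  simp only [h₁, h₂, h₃, h₄]

/-- **The forced auxiliary function, CKMRV (1.5)**: "In light of Theorem 1.7 and its interpolation
basis, we can write down the only possible auxiliary function `f` that could prove a sharp bound for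
`E₈` or the Leech lattice under a potential `p` (with `d = 8` or `24`, accordingly), at least among
radial Schwartz functions: `f(x) = ∑_{n ≥ n₀} p(√(2n)) aₙ(x) + ∑_{n ≥ n₀} p′(√(2n)) bₙ(x)`" — namely,
a radial Schwartz `f` satisfying the necessary conditions for a sharp bound, `f(√(2n)) = p(√(2n))`,
`f′(√(2n)) = p′(√(2n))`, `f̂(√(2n)) = f̂′(√(2n)) = 0` (`n ≥ n₀`; CKMRV (1.2)–(1.3) and the display
after Theorem 1.7), is given by that series. Here `p : ℝ → ℂ` is the radial profile of the
potential and `p′ = deriv p`. [cite: CohnEtAl2019, §1.5 (1.5)] -/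
theorem eq_forced (h : IsInterpolationBasis d n₀ a b a' b') (p : ℝ → ℂ)
    {f : 𝓢(EuclideanSpace ℝ (Fin d), ℂ)} (hf : IsRadial f)
    (hv : ∀ n, radialValue f (node n₀ n) = p (node n₀ n))
    (hd : ∀ n, radialDeriv f (node n₀ n) = deriv p (node n₀ n))
    (hv' : ∀ n, radialValue (𝓕 f : 𝓢(EuclideanSpace ℝ (Fin d), ℂ)) (node n₀ n) = 0)
    (hd' : ∀ n, radialDeriv (𝓕 f : 𝓢(EuclideanSpace ℝ (Fin d), ℂ)) (node n₀ n) = 0)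
    (x : EuclideanSpace ℝ (Fin d)) :
    f x = (∑' n, p (node n₀ n) * a n x) + ∑' n, deriv p (node n₀ n) * b n x := by
  rw [h.eq_tsum f hf x]
  simp [hv, hd, hv', hd']

end IsInterpolationBasis

/-! ## The named facts: CKMRV Theorems 1.7 and 1.9 for `(d, n₀) ∈ {(8, 1), (24, 2)}` -/

/-- **Cohn–Kumar–Miller–Radchenko–Viazovska interpolation theorem** (NAMED FACT; Ann. Math. 196
(2022), Theorem 1.7): "Let `(d, n₀)` be `(8, 1)` or `(24, 2)`. Then every `f ∈ 𝓢_rad(ℝᵈ)` is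
uniquely determined by the values `f(√(2n))`, `f′(√(2n))`, `f̂(√(2n))`, and `f̂′(√(2n))` for
integers `n ≥ n₀`. Specifically, there exists an interpolation basis `aₙ, bₙ, ãₙ, b̃ₙ ∈ 𝓢_rad(ℝᵈ)`
for `n ≥ n₀` such that for every `f ∈ 𝓢_rad(ℝᵈ)` and `x ∈ ℝᵈ`, (1.4)
`f(x) = ∑ f(√(2n)) aₙ(x) + ∑ f′(√(2n)) bₙ(x) + ∑ f̂(√(2n)) ãₙ(x) + ∑ f̂′(√(2n)) b̃ₙ(x)`,
where these series converge absolutely." Vendored as the existence of an `IsInterpolationBasis`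
in both cases (uniqueness is then `IsInterpolationBasis.eq_of_data_eq`). Radial Schwartz
functions are Mathlib Schwartz maps `𝓢(ℝᵈ, ℂ)` that are `IsRadial`; `f(r)`, `f′(r)` are
`radialValue`, `radialDeriv`. [cite: CohnEtAl2019, §1.4 Theorem 1.7] -/
def CKMRV2022_interpolationFormula : Prop :=
  (∃ a b a' b' : ℕ → 𝓢(EuclideanSpace ℝ (Fin 8), ℂ), IsInterpolationBasis 8 1 a b a' b') ∧
    ∃ a b a' b' : ℕ → 𝓢(EuclideanSpace ℝ (Fin 24), ℂ), IsInterpolationBasis 24 2 a b a' b'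

/-- **The interpolation isomorphism in dimension `d` from node `n₀`** (statement schema of CKMRV
Theorem 1.9 for a pair `(d, n₀)`): for every interpolation basis `(a, b, ã, b̃)` (by the theorem
itself such a basis is unique — CKMRV §1.4: "Such a basis is uniquely determined, by the
interpolation theorem itself" — so quantifying over all of them is the printed statement about
"the" basis of Theorem 1.7), the map `f ↦ ((f(√(2n)))ₙ, (f′(√(2n)))ₙ, (f̂(√(2n)))ₙ, (f̂′(√(2n)))ₙ)`
(i) sends radial Schwartz functions to `𝓢(ℕ)⁴`, and (ii) is onto `𝓢(ℕ)⁴` with inverse the series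
(1.4): for all rapidly decreasing `(αₙ), (βₙ), (α̃ₙ), (β̃ₙ)` the function
`∑ αₙ aₙ + ∑ βₙ bₙ + ∑ α̃ₙ ãₙ + ∑ β̃ₙ b̃ₙ` (pointwise, absolutely convergent series) is a radial
Schwartz function whose data are `(α, β, α̃, β̃)`; injectivity / left-inverse is (1.4) itself.
[cite: CohnEtAl2019, §1.4 Theorem 1.9] -/
def InterpolationIsomorphism (d n₀ : ℕ) [NeZero d] : Prop :=
  ∀ a b a' b' : ℕ → 𝓢(EuclideanSpace ℝ (Fin d), ℂ), IsInterpolationBasis d n₀ a b a' b' →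
    (∀ f : 𝓢(EuclideanSpace ℝ (Fin d), ℂ), IsRadial f →
      IsRapidlyDecreasing (fun n => radialValue f (node n₀ n)) ∧
      IsRapidlyDecreasing (fun n => radialDeriv f (node n₀ n)) ∧
      IsRapidlyDecreasing (fun n => radialValue (𝓕 f : 𝓢(EuclideanSpace ℝ (Fin d), ℂ)) (node n₀ n)) ∧
      IsRapidlyDecreasing (fun n => radialDeriv (𝓕 f : 𝓢(EuclideanSpace ℝ (Fin d), ℂ)) (node n₀ n))) ∧
    ∀ α β α' β' : ℕ → ℂ, IsRapidlyDecreasing α → IsRapidlyDecreasing β →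
      IsRapidlyDecreasing α' → IsRapidlyDecreasing β' →
      ∃ g : 𝓢(EuclideanSpace ℝ (Fin d), ℂ), IsRadial g ∧
        (∀ x, Summable (fun n => ‖α n * a n x‖) ∧ Summable (fun n => ‖β n * b n x‖) ∧
          Summable (fun n => ‖α' n * a' n x‖) ∧ Summable (fun n => ‖β' n * b' n x‖) ∧
          g x = (∑' n, α n * a n x) + (∑' n, β n * b n x) + (∑' n, α' n * a' n x) +
            (∑' n, β' n * b' n x)) ∧
        ∀ n, radialValue g (node n₀ n) = α n ∧ radialDeriv g (node n₀ n) = β n ∧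
          radialValue (𝓕 g : 𝓢(EuclideanSpace ℝ (Fin d), ℂ)) (node n₀ n) = α' n ∧
          radialDeriv (𝓕 g : 𝓢(EuclideanSpace ℝ (Fin d), ℂ)) (node n₀ n) = β' n

/-- **Cohn–Kumar–Miller–Radchenko–Viazovska, Theorem 1.9** (NAMED FACT): "Let `(d, n₀)` be
`(8, 1)` or `(24, 2)`. Then the map sending `f ∈ 𝓢_rad(ℝᵈ)` to
`((f(√(2n)))_{n ≥ n₀}, (f′(√(2n)))_{n ≥ n₀}, (f̂(√(2n)))_{n ≥ n₀}, (f̂′(√(2n)))_{n ≥ n₀})` is an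
isomorphism from `𝓢_rad(ℝᵈ)` to `𝓢(ℕ)⁴`, whose inverse is given by (1.4); i.e., the inverse
isomorphism maps `((αₙ), (βₙ), (α̃ₙ), (β̃ₙ))` to the function
`∑ αₙ aₙ + ∑ βₙ bₙ + ∑ α̃ₙ ãₙ + ∑ β̃ₙ b̃ₙ`." Here `𝓢(ℕ)` = rapidly decreasing sequences
(`IsRapidlyDecreasing`). [cite: CohnEtAl2019, §1.4 Theorem 1.9] -/
def CKMRV2022_interpolationIso : Prop :=
  InterpolationIsomorphism 8 1 ∧ InterpolationIsomorphism 24 2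

/-! ## Consequences of Theorem 1.9: the basis functions have Kronecker data -/

/-- **Kronecker data of the basis** (CKMRV §1.4, "Another consequence is that the values and
derivatives of the interpolation basis functions and their Fourier transforms at the interpolation
points are all `0` except for a single `1`": `aₙ(√(2m)) = δ_{m,n}`, `aₙ′(√(2m)) = 0`,
`âₙ(√(2m)) = 0`, `âₙ′(√(2m)) = 0`), derived from the isomorphism: the series with data
`(δₘ, 0, 0, 0)` is `aₘ` itself. (The statements for `bₙ`, `ãₙ`, `b̃ₙ` are obtained in the same
way.) [cite: CohnEtAl2019, §1.4 (display after Theorem 1.9)] -/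
theorem InterpolationIsomorphism.data_a [NeZero d] {n₀ : ℕ} (hI : InterpolationIsomorphism d n₀)
    {a b a' b' : ℕ → 𝓢(EuclideanSpace ℝ (Fin d), ℂ)} (h : IsInterpolationBasis d n₀ a b a' b')
    (m n : ℕ) :
    radialValue (a m) (node n₀ n) = (if n = m then 1 else 0) ∧ radialDeriv (a m) (node n₀ n) = 0 ∧
      radialValue (𝓕 (a m) : 𝓢(EuclideanSpace ℝ (Fin d), ℂ)) (node n₀ n) = 0 ∧
      radialDeriv (𝓕 (a m) : 𝓢(EuclideanSpace ℝ (Fin d), ℂ)) (node n₀ n) = 0 := by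
  classical
  set δ : ℕ → ℂ := fun n => if n = m then 1 else 0 with hδ_def
  have hδ : IsRapidlyDecreasing δ :=
    isRapidlyDecreasing_of_eventually_eq_zero <| by
      filter_upwards [eventually_gt_atTop m] with n hn
      simp [δ, hn.ne']
  obtain ⟨g, -, hgx, hdata⟩ := (hI a b a' b' h).2 δ 0 0 0 hδ isRapidlyDecreasing_zero
    isRapidlyDecreasing_zero isRapidlyDecreasing_zero
  have hga : g = a m := by
    ext x
    obtain ⟨-, -, -, -, hx⟩ := hgx x
    rw [hx]
    have h1 : (∑' n, δ n * a n x) = a m x := by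
      rw [tsum_eq_single m fun n hn => by simp [δ, hn]]
      simp [δ]
    simp [h1]
  simpa [hga, δ] using hdata n

end Literature.Analysis.Fourier
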